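import Literature.MathematicalPhysics.QuantumFieldTheory.Balaban1983to89.Beta.InterLevelTransport

/-!
# `BalabanUV.Beta.SLamFiniteSourceContraction` — binder row D1 ∕ (C1) OWNER an2 (gen 60), PART 8: **THE `SLam` DICTIONARY LEMMA THE ROAD ASKED FOR** (road FP
# d1-p3 g36 CLOSE l.67030, answering the row's INTENT-6 question «take it road-side or say which reading and the row types it» — «PLEASE TYPE IT»):
# for a finite top source `s` (bonds written `(site, direction)` as in the END wrapper: `ā.1` the site, `ā.2` the direction) with weights `h`, a scalar `w`,
# coefficients `c` and ANY brick family `Q2`,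
# `w · Σ_{ā ∈ s} h ā · SLam N c Q2 ā.2 ā.1 x z a b = −Σ_μ Σ'_y (w · Σ_{ā ∈ s} h ā · c μ y ā.2 ā.1) · Q2 μ y x z a b`
# (`InterLevelTransport.cwsum_apply` + one finite ∕ `tsum` swap under the summability of each `y ↦ c μ y ā.2 ā.1 · Q2 μ y x z a b`) — so the road's periodised
# core (`FP/TorusCompanionLamPacked` p409603 ✓, `h𝒦`) IS the `λ′`-contracted brick family with `λ′ μ y := −w · Σ_ā h ā · c μ y ā.2 ā.1` (the W-4 (3) fold, by value)

[folklore] `tsum` ∕ finite-sum bookkeeping over lit-balaban's `SLam ∕ cwsum` BY NAME; 0 `def`, 0 `def … : Prop`, 0 sorry, nothing cited; at every fibre pair `(a, b)`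
(the road reads `(inl e, inl e′)`).  NOT (C1), NOT D1, NEVER «G-an2-4 closed», NOT BetaPertH, NOT continuum, NOT Clay.
HONEST FRAMING (cell charter, verbatim): «discharging `BetaPertH` makes Bałaban's UV stability UNCONDITIONAL — a real constructive-QFT result; it is NOT
the continuum limit and NOT the Clay problem.»  HONEST DEPENDENCY (verbatim): «continuum YM on T⁴ ⇐ BetaPertH ∧ nine spine estimates (0/9 proved); BetaPertH ⇐
(D1) ∧ (D4) ∧ CAP+tail; G-an2-4 gates asym, D1 and NE2/3/4.»  ABSOLUTE RULE (cell, verbatim): «No internally-minted statement may enter as a cited fact. Every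
hypothesis is either kernel-proved in this package or a verbatim quotation of a PUBLISHED theorem with page reference.»
Unit `b2b-balaban-beta-an2` gen 60 (row-D1 owner), 2026-08-25; `bears_on: R4-O/T1|T1a` (bookkeeping toward the wrapper's `hHN₁`; moves no node counter).  No existing file touched.
-/

noncomputable section

namespace Summit.QuantumFields.BalabanUV.Beta.SLamFiniteSourceContraction

open Finset
open scoped BigOperators
open Literature.MathematicalPhysics.QuantumFieldTheory.Balaban1983to89.Beta
open OneStepResolventKernel (Fib)
open InterLevelTransport (SLam cwsum cwsum_apply)

variable {d N : ℕ} [NeZero N]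

/-- [folklore] `SLam` entrywise: `SLam N c Q2 κ′ u x z a b = −Σ_μ Σ'_y c μ y κ′ u · Q2 μ y x z a b` (`cwsum_apply`). -/
theorem SLam_apply_eq (c : Fin (d + 1) → (Fin (d + 1) → ℤ) → Fin (d + 1) → (Fin (d + 1) → ℤ) → ℝ)
    (Q2 : Fin (d + 1) → (Fin (d + 1) → ℤ) → ExpKernelCalculus.MKer (d + 1) (Fib d)) (κ' : Fin (d + 1)) (u x z : Fin (d + 1) → ℤ)
    (a b : Fib d) :
    SLam N c Q2 κ' u x z a b = -∑ μ : Fin (d + 1), ∑' y : Fin (d + 1) → ℤ, c μ y κ' u * Q2 μ y x z a b := by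
  unfold SLam
  simp only [cwsum_apply]

/-- [folklore] **THE FINITE-SOURCE CONTRACTION OF `SLam`** (road FP's dictionary lemma, d1-p3 g36 CLOSE): for a finite top source `s` with weights `h`, a scalar `w`,
and the summability of each slice `y ↦ c μ y ā.2 ā.1 · Q2 μ y x z a b` (`ā ∈ s`),
`w · Σ_{ā ∈ s} h ā · SLam N c Q2 ā.2 ā.1 x z a b = −Σ_μ Σ'_y (w · Σ_{ā ∈ s} h ā · c μ y ā.2 ā.1) · Q2 μ y x z a b`. -/
theorem mul_sum_mul_SLam_eq (c : Fin (d + 1) → (Fin (d + 1) → ℤ) → Fin (d + 1) → (Fin (d + 1) → ℤ) → ℝ)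
    (Q2 : Fin (d + 1) → (Fin (d + 1) → ℤ) → ExpKernelCalculus.MKer (d + 1) (Fib d)) (s : Finset ((Fin (d + 1) → ℤ) × Fin (d + 1)))
    (h : (Fin (d + 1) → ℤ) × Fin (d + 1) → ℝ) (w : ℝ) (x z : Fin (d + 1) → ℤ) (a b : Fib d)
    (hs : ∀ μ : Fin (d + 1), ∀ ā ∈ s, Summable fun y : Fin (d + 1) → ℤ => c μ y ā.2 ā.1 * Q2 μ y x z a b) :
    w * ∑ ā ∈ s, h ā * SLam N c Q2 ā.2 ā.1 x z a b
      = -∑ μ : Fin (d + 1), ∑' y : Fin (d + 1) → ℤ, (w * ∑ ā ∈ s, h ā * c μ y ā.2 ā.1) * Q2 μ y x z a b := by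
  -- unfold `SLam` slot by slot and pull the finite source sum and the scalar through the lattice sum
  have hterm : ∀ μ : Fin (d + 1),
      ∑' y : Fin (d + 1) → ℤ, (w * ∑ ā ∈ s, h ā * c μ y ā.2 ā.1) * Q2 μ y x z a b
        = w * ∑ ā ∈ s, h ā * ∑' y : Fin (d + 1) → ℤ, c μ y ā.2 ā.1 * Q2 μ y x z a b := by
    intro μ
    have hs' : ∀ ā ∈ s, Summable fun y : Fin (d + 1) → ℤ => h ā * (c μ y ā.2 ā.1 * Q2 μ y x z a b) :=
      fun ā hā => (hs μ ā hā).mul_left (h ā)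
    calc ∑' y : Fin (d + 1) → ℤ, (w * ∑ ā ∈ s, h ā * c μ y ā.2 ā.1) * Q2 μ y x z a b
        = ∑' y : Fin (d + 1) → ℤ, w * ∑ ā ∈ s, h ā * (c μ y ā.2 ā.1 * Q2 μ y x z a b) := by
          refine tsum_congr fun y => ?_
          rw [mul_assoc, Finset.sum_mul]
          exact congrArg (w * ·) (Finset.sum_congr rfl fun ā _ => by ring)
      _ = w * ∑' y : Fin (d + 1) → ℤ, ∑ ā ∈ s, h ā * (c μ y ā.2 ā.1 * Q2 μ y x z a b) := tsum_mul_left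
      _ = w * ∑ ā ∈ s, ∑' y : Fin (d + 1) → ℤ, h ā * (c μ y ā.2 ā.1 * Q2 μ y x z a b) := by
          rw [Summable.tsum_finsetSum hs']
      _ = w * ∑ ā ∈ s, h ā * ∑' y : Fin (d + 1) → ℤ, c μ y ā.2 ā.1 * Q2 μ y x z a b := by
          congr 1
          exact Finset.sum_congr rfl fun ā _ => tsum_mul_left
  simp_rw [hterm, SLam_apply_eq]
  simp only [mul_neg, Finset.mul_sum, Finset.sum_neg_distrib, neg_inj]
  rw [Finset.sum_comm]

/-- [folklore] The same with the road's sign convention made explicit: the `λ′`-contracted brick family with `λ′ μ y := −w · Σ_ā h ā · c μ y ā.2 ā.1`. -/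
theorem mul_sum_mul_SLam_eq' (c : Fin (d + 1) → (Fin (d + 1) → ℤ) → Fin (d + 1) → (Fin (d + 1) → ℤ) → ℝ)
    (Q2 : Fin (d + 1) → (Fin (d + 1) → ℤ) → ExpKernelCalculus.MKer (d + 1) (Fib d)) (s : Finset ((Fin (d + 1) → ℤ) × Fin (d + 1)))
    (h : (Fin (d + 1) → ℤ) × Fin (d + 1) → ℝ) (w : ℝ) (x z : Fin (d + 1) → ℤ) (a b : Fib d)
    (hs : ∀ μ : Fin (d + 1), ∀ ā ∈ s, Summable fun y : Fin (d + 1) → ℤ => c μ y ā.2 ā.1 * Q2 μ y x z a b) :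
    w * ∑ ā ∈ s, h ā * SLam N c Q2 ā.2 ā.1 x z a b
      = ∑ μ : Fin (d + 1), ∑' y : Fin (d + 1) → ℤ, (-(w * ∑ ā ∈ s, h ā * c μ y ā.2 ā.1)) * Q2 μ y x z a b := by
  rw [mul_sum_mul_SLam_eq c Q2 s h w x z a b hs, ← Finset.sum_neg_distrib]
  refine Finset.sum_congr rfl fun μ _ => ?_
  rw [← tsum_neg]
  exact tsum_congr fun y => by ring

end Summit.QuantumFields.BalabanUV.Beta.SLamFiniteSourceContraction

end
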